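import Mathlib.Analysis.Calculus.FDeriv.Bilinear
import Mathlib.Analysis.Calculus.ContDiff.Operations
import Mathlib.Analysis.Normed.Operator.Bilinear
import Mathlib.Analysis.Complex.Basic
import HarnessLib

/-!
# Second derivatives of a quadratic form composed with a linear map; its line Laplacian is constant

Layer `Literature/Analysis/Complex`; lane `lit-hodgefound`, prover seat `lit-hodgefound-p07`,
generation 19 — sixth rider towards FILE C (torus glue) of the programme «`[Θ_Ω] = -E_Ω` for every
`Ω ∈ 𝔥_g`». The exponent of the hermitian metric of the theta line bundle is the quadratic form
`q(z) = ᵗ(Im z)(Im Ω)⁻¹(Im z)` (Griffiths–Harris, Ch. 2 §6, p. 310: "`h(z) = e^{-π ᵗy Y⁻¹ y}`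
defines a metric on `L` […] with curvature form […] `(π/2) Σ Y⁻¹_{αβ} dz_α ∧ dz̄_β`"), i.e.
`Q = B ∘ (ℓ, ℓ)` for a continuous bilinear form `B` and a real-linear map `ℓ` (`z ↦ Im z`). We
record the calculus behind "the curvature of `e^{-π q}` is the constant form `H_Ω`":

* `hasFDerivAt_bilinear_comp_linear`, `fderiv_fderiv_bilinear_comp_linear` —
  `D²Q(x)[u, u'] = B(ℓu, ℓu') + B(ℓu', ℓu)` (constant in `x`);
* `contDiff_bilinear_comp_linear` — `Q` is smooth;
* `lineLaplacian_bilinear_comp_linear` — on a complex normed space, the Laplacian of `Q` along the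
  complex line `ℂ v`, `D²Q[v,v] + D²Q[iv,iv]`, is the constant `2 B(ℓv, ℓv) + 2 B(ℓ(iv), ℓ(iv))`.

Theorems only; no definitions, no named facts.

## References

* [GriffithsHarrisPrinciples1978] P. Griffiths, J. Harris, *Principles of Algebraic Geometry*
  (1978), Ch. 2 §6, pp. 307–310.
-/

noncomputable section

namespace Literature.Analysis.Complex

section Real

variable {V F : Type*} [NormedAddCommGroup V] [NormedSpace ℝ V] [NormedAddCommGroup F]
  [NormedSpace ℝ F] (B : F →L[ℝ] F →L[ℝ] ℝ) (ℓ : V →L[ℝ] F)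

/-- The first derivative of `Q = B(ℓ·, ℓ·)`: `DQ(y) = B(ℓy, ℓ·) + B(ℓ·, ℓy)`.
[cite: GriffithsHarrisPrinciples1978, Ch. 2 §6 (p. 310)] -/
theorem hasFDerivAt_bilinear_comp_linear (y : V) :
    HasFDerivAt (fun z => B (ℓ z) (ℓ z)) (B.precompR V (ℓ y) ℓ + B.precompL V ℓ (ℓ y)) y :=
  B.hasFDerivAt_of_bilinear ℓ.hasFDerivAt ℓ.hasFDerivAt

/-- **`D²Q(x)[u, u'] = B(ℓu, ℓu') + B(ℓu', ℓu)`** for the quadratic form `Q = B(ℓ·, ℓ·)`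
(independent of the base point). [cite: GriffithsHarrisPrinciples1978, Ch. 2 §6 (p. 310)] -/
theorem fderiv_fderiv_bilinear_comp_linear (x u u' : V) :
    fderiv ℝ (fderiv ℝ fun z => B (ℓ z) (ℓ z)) x u u' = B (ℓ u) (ℓ u') + B (ℓ u') (ℓ u) := by
  set T : F →L[ℝ] (V →L[ℝ] ℝ) := (B.precompR V).flip ℓ + B.precompL V ℓ with hT
  have hfd : fderiv ℝ (fun z => B (ℓ z) (ℓ z)) = fun y => T (ℓ y) := by
    funext y
    rw [(hasFDerivAt_bilinear_comp_linear B ℓ y).fderiv, hT, add_apply,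
      ContinuousLinearMap.flip_apply]
  have h2 : HasFDerivAt (fderiv ℝ fun z => B (ℓ z) (ℓ z)) (T.comp ℓ) x := by
    rw [hfd]
    exact T.hasFDerivAt.comp x ℓ.hasFDerivAt
  rw [h2.fderiv, hT]
  simp [ContinuousLinearMap.precompR_apply, ContinuousLinearMap.compL_apply]

/-- `Q = B(ℓ·, ℓ·)` is smooth. [cite: GriffithsHarrisPrinciples1978, Ch. 2 §6 (p. 310)] -/
theorem contDiff_bilinear_comp_linear {n : WithTop ℕ∞} : ContDiff ℝ n fun z => B (ℓ z) (ℓ z) :=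
  B.isBoundedBilinearMap.contDiff.comp (ℓ.contDiff.prodMk ℓ.contDiff)

end Real

section Complex

variable {V F : Type*} [NormedAddCommGroup V] [NormedSpace ℂ V] [NormedAddCommGroup F]
  [NormedSpace ℝ F] (B : F →L[ℝ] F →L[ℝ] ℝ) (ℓ : V →L[ℝ] F)

/-- **The line Laplacian of a quadratic form is constant**: on a complex normed space `V` (with its
underlying real structure), for `Q = B(ℓ·, ℓ·)` and any `v`,
`D²Q(x)[v,v] + D²Q(x)[iv,iv] = 2 B(ℓv, ℓv) + 2 B(ℓ(iv), ℓ(iv))` for every `x`. For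
`B = (Im Ω)⁻¹`, `ℓ = Im`, this is `2 H_Ω(v, v)` (`ᵗ(Im v)Y⁻¹(Im v) + ᵗ(Re v)Y⁻¹(Re v)`, as
`Im(iv) = Re v`). [cite: GriffithsHarrisPrinciples1978, Ch. 2 §6 (p. 310)] -/
theorem lineLaplacian_bilinear_comp_linear (x v : V) :
    fderiv ℝ (fderiv ℝ fun z => B (ℓ z) (ℓ z)) x v v +
        fderiv ℝ (fderiv ℝ fun z => B (ℓ z) (ℓ z)) x (Complex.I • v) (Complex.I • v) =
      2 * B (ℓ v) (ℓ v) + 2 * B (ℓ (Complex.I • v)) (ℓ (Complex.I • v)) := by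
  rw [fderiv_fderiv_bilinear_comp_linear, fderiv_fderiv_bilinear_comp_linear]
  ring

end Complex

end Literature.Analysis.Complex
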